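import Summits.ResolutionOfSingularities.ResolutionOfSingularities.Theorems.EquisingularLiftEquisingularLiftNatNoseResidueTopLocus
import HarnessLib

/-!
# [OURS · L1 W4.5(b) · EL♮(3)] NOSE RESIDUE STRUCTURE, brick 6 — (i) a singular curve of `H ⊂ ℙ³_k` has FINITELY many singular points of its own;
# (ii) an IRREDUCIBLE member of the liftable nose class₂ is an ATOM: a smooth complete intersection, a smooth determinantal locus, or a `rat` image

Cell `res-hironaka`, rung L, slot W4.5(b), D-0157 DOOR 1 width seat `res-L1-w45b-nose-w4` (desk WIDTH TABLE D1 row nose-w4, desk word (ii));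
crux CHILD EL♮(3) = stmt-ResolutionOfSingularities-20148 (parent EL♮ stmt-…-20038). OURS; NOT a statement of any manuscript; nothing of
[Hironaka2017] is asserted or used; AI kernel work, weaker than expert review. Resolution of singularities in positive characteristic is NOT proved here
(dimension 3 is a theorem in print, Cossart–Piltant 2008/2009). No `sorry`, no new definition, no instance, no notation; standard axioms.
`--kind proof --supports stmt-ResolutionOfSingularities-20148 --as helper`.  Sister files: `…NatNoseResidueUnfold`/`Core`/`TopLocus`/`ClassTwoRegular`/`Profile`/
`SingularLocusCensus` (bricks 1–5).

* §1 `singularCurve_redSub_facts` / `finite_singularPoints_of_singularCurve` — for `ι : H ↪ ℙ³_k` a closed immersion of an integral non-regular scheme and a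
  closed irreducible infinite `Z ⊆ ι(H)`, `ι(H) ⊄ Z` (a «singular curve» of bricks 2–5, or any curve on `H`): the reduced subscheme `Z̃ = redSub ℙ³ Z hZ` is
  INTEGRAL, NOETHERIAN, QUASI-EXCELLENT, of topological Krull dimension `1`, and its own non-regular locus `{z : Z̃ | ¬ IsRegularLocalRing 𝒪_{Z̃,z}}` is a
  FINITE set of CLOSED points (`StrataSplit.finite_compl_regularLocus_of_dim_le_one`).  Reading for branch (B2) of the trichotomy (brick 3): when the
  singular curve is itself singular, its bad points are finitely many closed points — the natural point-step prefix before any nose device.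
* §2 `isLiftableNoseClass_atom_of_isIrreducible` / `isLiftableNoseClass₂_atom_of_isIrreducible` — an IRREDUCIBLE member of lead-2's class (resp. of class₂)
  is given by ONE constructor's data: `ci` or `det` (resp. `ci`, `det` or `rat`); the `union` constructor is idle on irreducible sets (an irreducible union
  of two closed sets is one of them, Mathlib `isPreirreducible_iff_isClosed_union_isClosed`).  Reading for branch (A): a class₂ singular
  curve of `H` is LITERALLY a smooth complete-intersection curve, a smooth determinantal curve, or a closed-immersion image of some `ℙ^r` by forms of one degree.
-/

set_option linter.dupNamespace false

noncomputable section

open CategoryTheory CategoryTheory.Limits AlgebraicGeometry TopologicalSpace Topology IsLocalRing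
open Literature.AlgebraicGeometry.Resolution
open Literature.AlgebraicGeometry.Motives
open AlgebraicGeometry.Scheme.IdealSheafData
open Summit.ResolutionOfSingularities.ResolutionOfSingularities.Cruxes.EquisingularLift.StrataSplit

namespace Summit.ResolutionOfSingularities.ResolutionOfSingularities.Cruxes.EquisingularLiftNat.Sections

/-! ## §1 The singular points of a singular curve are finitely many closed points -/

/-- **The reduced subscheme of a curve on `H ⊂ ℙ³_k` is an integral, Noetherian, quasi-excellent scheme of dimension one.** [folklore] -/
theorem singularCurve_redSub_facts (k : Type) [Field k] (H : Scheme.{0}) (ι : H ⟶ (projectiveSpace 3 k).left)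
    [IsClosedImmersion ι] [IsIntegral H] (hH : ¬ Literature.AlgebraicGeometry.Resolution.Scheme.IsRegular H)
    {Z : Set (projectiveSpace 3 k).left} (hZ : IsClosed Z) (hZirr : IsIrreducible Z) (hZinf : Z.Infinite) (hZsub : Z ⊆ Set.range ι)
    (hZne : ¬ (Set.range ι ⊆ Z)) :
    IsIntegral (redSub (projectiveSpace 3 k).left Z hZ) ∧ IsNoetherian (redSub (projectiveSpace 3 k).left Z hZ) ∧
      Scheme.IsQuasiExcellent (redSub (projectiveSpace 3 k).left Z hZ) ∧ topologicalKrullDim ↥(redSub (projectiveSpace 3 k).left Z hZ) = 1 := by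
  obtain ⟨hN, hqe⟩ := isNoetherian_and_isQuasiExcellent_of_isClosedImmersion_projectiveSpace 3 (redSubι (projectiveSpace 3 k).left Z hZ)
  refine ⟨isIntegral_subscheme_vanishingIdeal ⟨Z, hZ⟩ hZirr, hN, hqe, ?_⟩
  have hhom : topologicalKrullDim ↥(redSub (projectiveSpace 3 k).left Z hZ) =
      topologicalKrullDim (Set.range (redSubι (projectiveSpace 3 k).left Z hZ)) :=
    IsHomeomorph.topologicalKrullDim_eq _ (redSubι (projectiveSpace 3 k).left Z hZ).isClosedEmbedding.isEmbedding.toHomeomorph.isHomeomorph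
  rw [hhom, range_subschemeι_vanishingIdeal]
  exact topologicalKrullDim_eq_one_of_three k H ι hH hZ hZinf hZsub hZne

/-- **A singular curve has finitely many singular points, all closed.** For `ι : H ↪ ℙ³_k` a closed immersion of an integral non-regular scheme and a closed
irreducible infinite `Z ⊆ ι(H)` with `ι(H) ⊄ Z`, the non-regular locus of the reduced curve `Z̃ = redSub ℙ³ Z hZ` is a finite set of closed points of `Z̃`
(an integral Noetherian quasi-excellent scheme of dimension `1` has finitely many non-regular points, tree `StrataSplit.finite_compl_regularLocus_of_dim_le_one`).
[folklore] -/
theorem finite_singularPoints_of_singularCurve (k : Type) [Field k] (H : Scheme.{0}) (ι : H ⟶ (projectiveSpace 3 k).left)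
    [IsClosedImmersion ι] [IsIntegral H] (hH : ¬ Literature.AlgebraicGeometry.Resolution.Scheme.IsRegular H)
    {Z : Set (projectiveSpace 3 k).left} (hZ : IsClosed Z) (hZirr : IsIrreducible Z) (hZinf : Z.Infinite) (hZsub : Z ⊆ Set.range ι)
    (hZne : ¬ (Set.range ι ⊆ Z)) :
    {z : ↥(redSub (projectiveSpace 3 k).left Z hZ) | ¬ IsRegularLocalRing ((redSub (projectiveSpace 3 k).left Z hZ).presheaf.stalk z)}.Finite ∧
      ∀ z : ↥(redSub (projectiveSpace 3 k).left Z hZ), ¬ IsRegularLocalRing ((redSub (projectiveSpace 3 k).left Z hZ).presheaf.stalk z) →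
        IsClosed ({z} : Set ↥(redSub (projectiveSpace 3 k).left Z hZ)) := by
  obtain ⟨hint, hN, hqe, hdim⟩ := singularCurve_redSub_facts k H ι hH hZ hZirr hZinf hZsub hZne
  haveI := hint
  haveI := hN
  obtain ⟨hfin, hcl⟩ := finite_compl_regularLocus_of_dim_le_one hqe hdim.le
  exact ⟨hfin, fun z hz => hcl z hz⟩

/-! ## §2 Irreducible members of the nose classes are atoms -/

/-- An IRREDUCIBLE union `Z₁ ∪ Z₂` of two closed sets is one of them: `Z₁ ∪ Z₂ = Z₁` or `Z₁ ∪ Z₂ = Z₂`. [folklore] -/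
theorem union_eq_left_or_right_of_isIrreducible {X : Type*} [TopologicalSpace X] {Z₁ Z₂ : Set X} (h₁ : IsClosed Z₁) (h₂ : IsClosed Z₂)
    (hirr : IsIrreducible (Z₁ ∪ Z₂)) : Z₁ ∪ Z₂ = Z₁ ∨ Z₁ ∪ Z₂ = Z₂ := by
  rcases (isPreirreducible_iff_isClosed_union_isClosed.mp hirr.isPreirreducible) Z₁ Z₂ h₁ h₂ subset_rfl with h | h
  · exact Or.inl (Set.Subset.antisymm h Set.subset_union_left)
  · exact Or.inr (Set.Subset.antisymm h Set.subset_union_right)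

/-- **An IRREDUCIBLE member of lead-2's liftable nose class is an atom**: it is the common zero set of smooth complete-intersection data (`ci`) or the
maximal-minor locus of smooth determinantal data (`det`); the `union` constructor is idle on irreducible sets. [OURS · L1 W4.5b · pure logic + topology] -/
theorem isLiftableNoseClass_atom_of_isIrreducible (k : Type) [Field k] (n : ℕ) {Z : Set (projectiveSpace n k).left}
    (h : IsLiftableNoseClass k n Z) (hirr : IsIrreducible Z) :
    letI := MvPolynomial.gradedAlgebra (σ := Fin (n + 1)) (R := k);
    (∃ (c : ℕ) (f : Fin c → MvPolynomial (Fin (n + 1)) k) (d : Fin c → ℕ),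
        ((∀ i, 1 ≤ d i ∧ f i ∈ MvPolynomial.homogeneousSubmodule (Fin (n + 1)) k (d i)) ∧
          Set.Nonempty {y : (projectiveSpace n k).left | ∀ i, f i ∈ (y : ProjectiveSpectrum (MvPolynomial.homogeneousSubmodule (Fin (n + 1)) k)).asHomogeneousIdeal} ∧
          (∀ y ∈ {y : (projectiveSpace n k).left | ∀ i, f i ∈ (y : ProjectiveSpectrum (MvPolynomial.homogeneousSubmodule (Fin (n + 1)) k)).asHomogeneousIdeal},
            ∃ e : Fin c ↪ Fin (n + 1), Matrix.det (Matrix.of fun i j => MvPolynomial.pderiv (e j) (f i)) ∉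
              (y : ProjectiveSpectrum (MvPolynomial.homogeneousSubmodule (Fin (n + 1)) k)).asHomogeneousIdeal) ∧
          IsClosed {y : (projectiveSpace n k).left | ∀ i, f i ∈ (y : ProjectiveSpectrum (MvPolynomial.homogeneousSubmodule (Fin (n + 1)) k)).asHomogeneousIdeal}) ∧
        Z = {y : (projectiveSpace n k).left | ∀ i, f i ∈ (y : ProjectiveSpectrum (MvPolynomial.homogeneousSubmodule (Fin (n + 1)) k)).asHomogeneousIdeal}) ∨
    (∃ (t : ℕ) (M : Matrix (Fin (t + 1)) (Fin t) (MvPolynomial (Fin (n + 1)) k)) (α : Fin (t + 1) → ℕ) (β : Fin t → ℕ),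
        ((∀ a b, M a b ∈ MvPolynomial.homogeneousSubmodule (Fin (n + 1)) k (α a + β b)) ∧
          (∀ y ∈ {y : (projectiveSpace n k).left | ∀ l : Fin (t + 1), (M.submatrix l.succAbove id).det ∈
              (y : ProjectiveSpectrum (MvPolynomial.homogeneousSubmodule (Fin (n + 1)) k)).asHomogeneousIdeal},
            ∃ (a b : Fin (t + 1)) (e : Fin 2 ↪ Fin (n + 1)),
              Matrix.det (Matrix.of fun r s => MvPolynomial.pderiv (e s) (![(M.submatrix a.succAbove id).det, (M.submatrix b.succAbove id).det] r)) ∉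
                (y : ProjectiveSpectrum (MvPolynomial.homogeneousSubmodule (Fin (n + 1)) k)).asHomogeneousIdeal) ∧
          IsClosed {y : (projectiveSpace n k).left | ∀ l : Fin (t + 1), (M.submatrix l.succAbove id).det ∈
            (y : ProjectiveSpectrum (MvPolynomial.homogeneousSubmodule (Fin (n + 1)) k)).asHomogeneousIdeal}) ∧
        Z = {y : (projectiveSpace n k).left | ∀ l : Fin (t + 1), (M.submatrix l.succAbove id).det ∈
          (y : ProjectiveSpectrum (MvPolynomial.homogeneousSubmodule (Fin (n + 1)) k)).asHomogeneousIdeal}) := by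
  induction h with
  | ci c f d h => exact Or.inl ⟨c, f, d, h, rfl⟩
  | det t M α β h => exact Or.inr ⟨t, M, α, β, h, rfl⟩
  | union Z₁ Z₂ h₁ h₂ _ ih₁ ih₂ =>
    rcases union_eq_left_or_right_of_isIrreducible h₁.isClosed h₂.isClosed hirr with heq | heq
    · rw [heq] at hirr ⊢; exact ih₁ hirr
    · rw [heq] at hirr ⊢; exact ih₂ hirr

/-- **An IRREDUCIBLE member of the liftable nose class₂ is an atom**: v1-class atom (`ci` / `det`, via `isLiftableNoseClass_atom_of_isIrreducible`) or a `rat`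
atom (the locus `{y | ker (aeval f) ≤ 𝔮_y}` of a parametrisation by forms of one degree with the cofinite clause); `union` is idle on irreducible sets.
Reading for branch (A) of the residue's singular-curve trichotomy (brick 3): a class₂ singular curve of `H` is literally a smooth complete-intersection curve, a
smooth determinantal curve, or a `rat` image. [OURS · L1 W4.5b · pure logic + topology] -/
theorem isLiftableNoseClass₂_atom_of_isIrreducible (k : Type) [Field k] (n : ℕ) {Z : Set (projectiveSpace n k).left}
    (h : IsLiftableNoseClass₂ k n Z) (hirr : IsIrreducible Z) :
    (IsLiftableNoseClass k n Z ∧ IsIrreducible Z) ∨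
    letI := MvPolynomial.gradedAlgebra (σ := Fin (n + 1)) (R := k);
    (∃ (r e m₀ : ℕ) (f : Fin (n + 1) → MvPolynomial (Fin (r + 1)) k),
        ((∀ i, (f i).IsHomogeneous e) ∧ 0 < e ∧
          (∀ m, m₀ ≤ m → MvPolynomial.homogeneousSubmodule (Fin (r + 1)) k (e * m) ≤
            (MvPolynomial.homogeneousSubmodule (Fin (n + 1)) k m).map (MvPolynomial.aeval (R := k) f).toLinearMap)) ∧
        Z = {y : (projectiveSpace n k).left |
          RingHom.ker (MvPolynomial.aeval (R := k) f) ≤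
            (y : ProjectiveSpectrum (MvPolynomial.homogeneousSubmodule (Fin (n + 1)) k)).asHomogeneousIdeal.toIdeal}) := by
  induction h with
  | base Z h => exact Or.inl ⟨h, hirr⟩
  | rat r e m₀ f h => exact Or.inr ⟨r, e, m₀, f, h, rfl⟩
  | union Z₁ Z₂ h₁ h₂ _ ih₁ ih₂ =>
    rcases union_eq_left_or_right_of_isIrreducible h₁.isClosed h₂.isClosed hirr with heq | heq
    · rw [heq] at hirr ⊢; exact ih₁ hirr
    · rw [heq] at hirr ⊢; exact ih₂ hirr

end Summit.ResolutionOfSingularities.ResolutionOfSingularities.Cruxes.EquisingularLiftNat.Sections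

end
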